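import Mathlib
import Literature.NumberTheory.Irrationality.RhinViola2001.Theorem21Integrals
import Literature.NumberTheory.Irrationality.RhinViola2001.ThetaInvarianceProofs
import HarnessLib

/-!
# Rhin–Viola 2001, Theorem 2.1 — III: the descent, for every dominating triple, and the denominators (5.3) of §5

Topic `Literature/NumberTheory/Irrationality/RhinViola2001`. Third of three files (cell `zeta5-irr`, seat zi-lit g11) on
G. Rhin, C. Viola, *The group structure for ζ(3)*, Acta Arith. **97** (2001) 269–293 [RhinViola2001], **Theorem 2.1**
— "Let `h, j, k, l, m, q, r, s` be non-negative integers satisfying `h + m = k + r` and `j + q = l + s`. Let `S` denote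
the sequence of the integers (2.8) … and let `M = max S`, `N = max′ S`, `Q = max″ S`. Then the integral
`I = I(h,j,k,l,m,q,r,s)` satisfies (2.9) `I = a + 2bζ(3)` with `d_M d_N d_Q a ∈ ℤ` and `b ∈ ℤ`."

The named fact `theorem21` itself was discharged IN PARALLEL by the cell pub-zeta5 (seat denom-lit g45,
`TheoremTwoOneProofs.lean`, `theorem21_holds`, landed while this file was being written; same printed proof). This file
keeps what that discharge does not state: Theorem 2.1 for EVERY triple `M, N, Q` dominating the integers (2.8) in the
counting sense (`Theorem21.main` / `theorem21_of_dom`: no entry exceeds `M`, at most one exceeds `N`, at most two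
exceed `Q`) — which is how the theorem is USED in §5, where (5.3) "`M = max T`, `N = max′ T`, `Q = max″ T`" are the
successive maxima of the SIXTEEN integers `T = (h, …, s, h′, …, s′)` and "By Theorem 2.1 we have `d_M d_N d_Q a ∈ ℤ` and
`b ∈ ℤ`" (p. 287): `theorem21_maxT`, and for `I_n = I(hn, …, sn) = a_n + 2b_nζ(3)` (5.2) the integrality
`d_{Mn} d_{Nn} d_{Qn} a_n ∈ ℤ` behind "the integer `A_n = d_{Mn} d_{Nn} d_{Qn} a_n`" (p. 287): `theorem21_scale`.

The proof is the PRINTED one (pp. 274–275, held text `paper:doi-10-4064-aa97-3-6`, read on the page), organised as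
an induction on `h+j+k+l+m+q+r+s` (`Theorem21.total`; invariant under `ϑ`, `σ`, strictly decreasing along (2.10)) of
the statement "for all `M, N, Q` dominating the integers (2.8) in the counting sense (`Theorem21.Dom`),
`I(P) = a + 2bζ(3)` with `d_M d_N d_Q a ∈ ℤ`, `b ∈ ℤ`" (`Theorem21.main`), through the printed case distinction
(`Theorem21.step`):

* "If `q + h − r < 0`, then `I` is the integral of a polynomial … `d_M d_N d_Q I ∈ ℤ`, so that (2.9) holds with
  `b = 0`. If `q + h − r ≥ 0` but the least of the integers (2.8) is `< 0`, then `I` is changed by a suitable power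
  of the permutation `ϑ` into an integral of the preceding type" (`good_of_lt`, `good_of_aux_neg`; `ϑ` acts on the
  integrals by the tree's `ThetaInvariance.I_theta`);
* "If the integers (2.8) are all `≥ 0` and if `lmqr > 0`, we use the linear decomposition (2.10) … Thus if Theorem
  2.1 holds for the three integrals, it also holds for `I`"; "if `lmqr = 0` but the greatest of the integers `mqrs,
  qrsh, rshj, shjk, hjkl, jklm, klmq` is `> 0`, we apply to that integral first a suitable power of the permutation
  `ϑ`, and then the linear decomposition (2.10)" (`good_of_decomp`, `good_of_rot_decomp`);
* the terminal parameters (`lmqr = mqrs = ⋯ = klmq = 0`, all of (2.8) `≥ 0`), "up to applying a suitable power of `ϑ`,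
  `j = 0`": First case `j = q = 0` ⇒ `h = k = m = r`, the integral (2.11) (`good_first_case`, from
  `Theorem21.good_baseP`); Second case `j = 0, q > 0` ⇒ `mr = 0`, "`σ` interchanges the cases `m = 0` and `r = 0`",
  `r = 0` ⇒ `s = 0`, `l = q`; `k = 0` ⇒ "`ϑ` changes the integral into one having `j = q = 0`"; `k > 0` ⇒ `m = 0` ⇒
  `j + m − k = −k < 0`, excluded (`good_caseR0`, `good_terminal_j0`).

Everything is PROVED; no definition (beyond those of parts I–II), no named fact, no new hypothesis. HONEST FRAMING (cells pub-zeta5 / zeta5-irr): Rhin–Viola's `ζ(3)`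
arithmetic AS PRINTED in 2001 (the input of their `μ(ζ(3)) < 5.513891`, `ZetaThreeMeasure.lean`); nothing here
concerns `ζ(5)`; records in print unmoved.
-/

noncomputable section

namespace Literature.NumberTheory.Irrationality.RhinViola2001

namespace Theorem21

open Literature.NumberTheory.Transcendental (zetaValue)

/-! ### Transport along `ϑ`, `σ` -/

/-- `I(ϑ^i P) = I(P)` (the tree's `ThetaInvariance.I_theta`, iterated). [cite: RhinViola2001, §2 p. 272] -/
theorem I_rot (P : Params) (hB : P.Balanced) : ∀ i, I (rot i P) = I P
  | 0 => rfl
  | i + 1 => by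
    show I (theta (rot i P)) = I P
    rw [ThetaInvariance.I_theta _ (balanced_rot hB i), I_rot P hB i]

/-- The integers (2.8) of `ϑP` are non-negative when those of `P` are. [cite: RhinViola2001, §2 p. 273] -/
theorem auxNonneg_theta {P : Params} (h : P.aux.Nonneg) : (theta P).aux.Nonneg := by
  rw [aux_theta]; exact nonneg_theta h

/-- The integers (2.8) of `σP` are non-negative when those of `P` are. [cite: RhinViola2001, §2 p. 273] -/
theorem auxNonneg_sigma {P : Params} (hB : P.Balanced) (h : P.aux.Nonneg) : (sigma P).aux.Nonneg := by
  rw [aux_sigma hB]; exact nonneg_sigma h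

/-- The integers (2.8) of `ϑ^i P` are non-negative when those of `P` are. [cite: RhinViola2001, §2 p. 273] -/
theorem auxNonneg_rot {P : Params} (h : P.aux.Nonneg) : ∀ i, (rot i P).aux.Nonneg
  | 0 => h
  | i + 1 => auxNonneg_theta (auxNonneg_rot h i)

/-- `ϑP` on the parameters, explicitly (plumbing). [folklore] -/
private theorem rot_one (P : Params) : rot 1 P = ⟨P.j, P.k, P.l, P.m, P.q, P.r, P.s, P.h⟩ := rfl

/-- `ϑ²P` on the parameters, explicitly (plumbing). [folklore] -/
private theorem rot_two (P : Params) : rot 2 P = ⟨P.k, P.l, P.m, P.q, P.r, P.s, P.h, P.j⟩ := rfl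

/-- `ϑ³P` on the parameters, explicitly (plumbing). [folklore] -/
private theorem rot_three (P : Params) : rot 3 P = ⟨P.l, P.m, P.q, P.r, P.s, P.h, P.j, P.k⟩ := rfl

/-- `ϑ⁴P` on the parameters, explicitly (plumbing). [folklore] -/
private theorem rot_four (P : Params) : rot 4 P = ⟨P.m, P.q, P.r, P.s, P.h, P.j, P.k, P.l⟩ := rfl

/-- `ϑ⁵P` on the parameters, explicitly (plumbing). [folklore] -/
private theorem rot_five (P : Params) : rot 5 P = ⟨P.q, P.r, P.s, P.h, P.j, P.k, P.l, P.m⟩ := rfl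

/-- `ϑ⁶P` on the parameters, explicitly (plumbing). [folklore] -/
private theorem rot_six (P : Params) : rot 6 P = ⟨P.r, P.s, P.h, P.j, P.k, P.l, P.m, P.q⟩ := rfl

/-- `ϑ⁷P` on the parameters, explicitly (plumbing). [folklore] -/
private theorem rot_seven (P : Params) : rot 7 P = ⟨P.s, P.h, P.j, P.k, P.l, P.m, P.q, P.r⟩ := rfl

/-! ### The cases of the printed proof -/

/-- "If `q + h − r < 0`, then `I` is the integral of a polynomial … Since `r+l−q`, `m+s−q` and `j+r−h` occur in
distinct places in the list (2.8), we get `d_M d_N d_Q I ∈ ℤ`, so that (2.9) holds with `b = 0`."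
[cite: RhinViola2001, §2 p. 274] -/
theorem good_of_lt {P : Params} (hN : P.Nonneg) (hB : P.Balanced) (hlt : P.q + P.h - P.r < 0) {M N Q : ℤ}
    (hD : Dom P.S M N Q) : Good (d M * d N * d Q) (I P) := by
  obtain ⟨A, hA⟩ := exists_int_of_lt hN hB hlt
  have hne : d P.aux.r * d P.aux.m * d P.aux.j ≠ 0 := by
    unfold d
    exact mul_ne_zero (mul_ne_zero (Nat.lcmUpto_ne_zero _) (Nat.lcmUpto_ne_zero _)) (Nat.lcmUpto_ne_zero _)
  have h1 : Good (d P.aux.r * d P.aux.m * d P.aux.j) (I P) := good_of_mul_eq_int hne hA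
  refine h1.mono ?_
  calc d P.aux.r * d P.aux.m * d P.aux.j = d P.aux.j * d P.aux.m * d P.aux.r := by ring
    _ ∣ d M * d N * d Q := dvd_of_dom hD (subperm_S_jmr P)

/-- The polynomial case after a rotation `ϑ^i`. [cite: RhinViola2001, §2 p. 274] -/
private theorem good_of_rot_lt {P : Params} (hN : P.Nonneg) (hB : P.Balanced) (i : ℕ)
    (hlt : (rot i P).q + (rot i P).h - (rot i P).r < 0) {M N Q : ℤ} (hD : Dom P.S M N Q) :
    Good (d M * d N * d Q) (I P) := by
  have := good_of_lt (nonneg_rot hN i) (balanced_rot hB i) hlt ((dom_perm (S_rot_perm P i)).2 hD)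
  rwa [I_rot P hB i] at this

/-- "If `q + h − r ≥ 0` but the least of the integers (2.8) is `< 0`, then `I` is changed by a suitable power of the
permutation `ϑ` into an integral of the preceding type, and again we obtain `d_M d_N d_Q I ∈ ℤ`, since `M`, `N` and
`Q` are invariant under the actions of `ϑ` and `σ`." [cite: RhinViola2001, §2 p. 274] -/
theorem good_of_aux_neg {P : Params} (hN : P.Nonneg) (hB : P.Balanced) (hneg : ∃ x ∈ P.S, x < 0) {M N Q : ℤ}
    (hD : Dom P.S M N Q) : Good (d M * d N * d Q) (I P) := by
  obtain ⟨x, hx, hx0⟩ := hneg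
  simp only [Params.S, Params.toList, List.mem_cons, List.not_mem_nil, or_false] at hx
  simp only [Params.aux] at hx
  rcases hx with rfl | rfl | rfl | rfl | rfl | rfl | rfl | rfl
  · exact good_of_rot_lt hN hB 3 (by rw [rot_three]; simp only; omega) hD
  · exact good_of_rot_lt hN hB 4 (by rw [rot_four]; simp only; omega) hD
  · exact good_of_rot_lt hN hB 5 (by rw [rot_five]; simp only; omega) hD
  · exact good_of_rot_lt hN hB 6 (by rw [rot_six]; simp only; omega) hD
  · exact good_of_rot_lt hN hB 7 (by rw [rot_seven]; simp only; omega) hD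
  · exact good_of_rot_lt hN hB 0 (by show P.q + P.h - P.r < 0; omega) hD
  · exact good_of_rot_lt hN hB 1 (by rw [rot_one]; simp only; omega) hD
  · exact good_of_rot_lt hN hB 2 (by rw [rot_two]; simp only; omega) hD

/-- "If the integers (2.8) are all `≥ 0` and if `lmqr > 0`, we use the linear decomposition of `I` given by the
identity `(1−x)(1−z) = 1−x−(1−x)z` … Thus if Theorem 2.1 holds for the three integrals, it also holds for `I`."
(the inductive step along (2.10)). [cite: RhinViola2001, §2 pp. 274–275] -/
theorem good_of_decomp (P : Params) (hN : P.Nonneg) (hB : P.Balanced) (hl : 1 ≤ P.l) (hm : 1 ≤ P.m)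
    (hq : 1 ≤ P.q) (hr : 1 ≤ P.r)
    (IH : ∀ P' : Params, P'.Nonneg → P'.Balanced → total P' < total P →
      ∀ M N Q : ℤ, Dom P'.S M N Q → Good (d M * d N * d Q) (I P'))
    {M N Q : ℤ} (hD : Dom P.S M N Q) : Good (d M * d N * d Q) (I P) := by
  rw [I_decomp hN hB hl hm hq hr]
  have gA := IH (childA P) (nonneg_childA hN hl hm hq hr) (balanced_childA hB)
    (by rw [total_childA]; omega) M N Q (dom_mono (S_childA_le P) hD)
  have gB := IH (childB P) (nonneg_childB hN hl hm hq) (balanced_childB hB)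
    (by rw [total_childB]; omega) M N Q (dom_mono (S_childB_le P) hD)
  have gC := IH (childC P) (nonneg_childC hN hm hq hr) (balanced_childC hB)
    (by rw [total_childC]; omega) M N Q (dom_mono (S_childC_le P) hD)
  exact (gA.sub gB).sub gC

/-- "If, for such an integral, `lmqr = 0` but the greatest of the integers `mqrs, qrsh, rshj, shjk, hjkl, jklm, klmq`
is `> 0`, we apply to that integral first a suitable power of the permutation `ϑ`, and then the linear decomposition
(2.10)." [cite: RhinViola2001, §2 p. 275] -/
theorem good_of_rot_decomp (P : Params) (hN : P.Nonneg) (hB : P.Balanced) (i : ℕ)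
    (hw : 1 ≤ (rot i P).l ∧ 1 ≤ (rot i P).m ∧ 1 ≤ (rot i P).q ∧ 1 ≤ (rot i P).r)
    (IH : ∀ P' : Params, P'.Nonneg → P'.Balanced → total P' < total P →
      ∀ M N Q : ℤ, Dom P'.S M N Q → Good (d M * d N * d Q) (I P'))
    {M N Q : ℤ} (hD : Dom P.S M N Q) : Good (d M * d N * d Q) (I P) := by
  have IH' : ∀ P' : Params, P'.Nonneg → P'.Balanced → total P' < total (rot i P) →
      ∀ M N Q : ℤ, Dom P'.S M N Q → Good (d M * d N * d Q) (I P') := by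
    rw [total_rot]; exact IH
  have := good_of_decomp (rot i P) (nonneg_rot hN i) (balanced_rot hB i) hw.1 hw.2.1 hw.2.2.1 hw.2.2.2 IH'
    ((dom_perm (S_rot_perm P i)).2 hD)
  rwa [I_rot P hB i] at this

/-- "First case: `j = q = 0`. By (2.3) we have `l = s = 0`. If `h ≠ k`, the least of the integers (2.8) is `< 0` … If
`h = k = m = r`, the integral is (2.11) … Hence, for this integral, (2.9) holds with `d_{3h} a ∈ ℤ` and `b = 1` …
we get `d_M d_N d_Q a = d_h³ a ∈ ℤ`." (all of (2.8) being `≥ 0`, the parameters ARE `(h,0,h,0,h,0,h,0)`).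
[cite: RhinViola2001, §2 p. 275 (First case) and (2.11)] -/
theorem good_first_case (P : Params) (hN : P.Nonneg) (hB : P.Balanced) (haux : P.aux.Nonneg) (hj : P.j = 0)
    (hq : P.q = 0) {M N Q : ℤ} (hD : Dom P.S M N Q) : Good (d M * d N * d Q) (I P) := by
  obtain ⟨h0, h1, h2, h3, h4, h5, h6, h7⟩ := hN
  obtain ⟨a0, a1, a2, a3, a4, a5, a6, a7⟩ := haux
  obtain ⟨b1, b2⟩ := hB
  simp only [Params.aux] at a0 a1 a2 a3 a4 a5 a6 a7
  obtain ⟨t, ht⟩ : ∃ t : ℕ, P.h = t := ⟨P.h.toNat, (Int.toNat_of_nonneg h0).symm⟩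
  have key : P = baseP (t : ℤ) := by
    ext <;> simp only [baseP] <;> omega
  subst key
  exact (good_baseP t).mono (dvd_of_dom hD (subperm_S_baseP t))

/-- Second case, `r = 0`: "If `s > 0` we get `r + j − s = −s < 0` … Thus we may assume `s = 0`. Then, by (2.3), we
have `l = q > 0`. If `k = 0`, since `r = 0`, the permutation `ϑ` changes the integral into one having `j = q = 0`,
and this has been treated in the first case above. Hence we may assume `k > 0`. Since `klm = 0` and `kl > 0`, we get
`m = 0`, whence `j + m − k = −k < 0`" (excluded, all of (2.8) being `≥ 0`). [cite: RhinViola2001, §2 p. 275 (Second case)] -/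
theorem good_caseR0 (P : Params) (hN : P.Nonneg) (hB : P.Balanced) (haux : P.aux.Nonneg) (hj : P.j = 0)
    (hq : 0 < P.q) (hr : P.r = 0) (w7 : ¬(0 < P.k ∧ 0 < P.l ∧ 0 < P.m ∧ 0 < P.q)) {M N Q : ℤ}
    (hD : Dom P.S M N Q) : Good (d M * d N * d Q) (I P) := by
  by_cases hk : P.k = 0
  · -- `ϑP` has `j = q = 0`
    have := good_first_case (theta P) (nonneg_theta hN) (balanced_theta hB) (auxNonneg_theta haux)
      (by simp only [theta]; exact hk) (by simp only [theta]; exact hr) ((dom_perm (S_theta_perm P)).2 hD)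
    rwa [ThetaInvariance.I_theta P hB] at this
  · exfalso
    obtain ⟨h0, h1, h2, h3, h4, h5, h6, h7⟩ := hN
    obtain ⟨a0, a1, a2, a3, a4, a5, a6, a7⟩ := haux
    obtain ⟨b1, b2⟩ := hB
    simp only [Params.aux] at a0 a1 a2 a3 a4 a5 a6 a7
    omega

/-- The terminal parameters with `j = 0`: "First case: `j = q = 0` … Second case: `j = 0`, `q > 0`. Then
`lmr = mrs = rsh = klm = 0`. If we had `mr > 0` we should obtain `l = s = 0`, whence, by (2.3), `q = l + s − j = 0`,
contradicting the assumption `q > 0`. Therefore `mr = 0`. The permutation `σ` interchanges the cases `m = 0` and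
`r = 0`, so we may assume, e.g., `r = 0`." [cite: RhinViola2001, §2 p. 275] -/
theorem good_terminal_j0 (P : Params) (hN : P.Nonneg) (hB : P.Balanced) (haux : P.aux.Nonneg) (hj : P.j = 0)
    (w0 : ¬(0 < P.l ∧ 0 < P.m ∧ 0 < P.q ∧ 0 < P.r)) (w1 : ¬(0 < P.m ∧ 0 < P.q ∧ 0 < P.r ∧ 0 < P.s))
    (w2 : ¬(0 < P.q ∧ 0 < P.r ∧ 0 < P.s ∧ 0 < P.h)) (w7 : ¬(0 < P.k ∧ 0 < P.l ∧ 0 < P.m ∧ 0 < P.q))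
    {M N Q : ℤ} (hD : Dom P.S M N Q) : Good (d M * d N * d Q) (I P) := by
  by_cases hq0 : P.q = 0
  · exact good_first_case P hN hB haux hj hq0 hD
  have hN' := hN
  obtain ⟨h0, h1, h2, h3, h4, h5, h6, h7⟩ := hN'
  have hq : 0 < P.q := lt_of_le_of_ne h5 (Ne.symm hq0)
  have hmr : P.m = 0 ∨ P.r = 0 := by
    have := hB.2
    omega
  rcases hmr with hm0 | hr0
  · -- `σ` interchanges the cases `m = 0` and `r = 0`
    have := good_caseR0 (sigma P) (nonneg_sigma hN) (balanced_sigma hB) (auxNonneg_sigma hB haux)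
      (by simp only [sigma]; exact hj) (by simp only [sigma]; exact hq) (by simp only [sigma]; exact hm0)
      (by simp only [sigma]; omega) ((dom_perm (S_sigma_perm hB)).2 hD)
    rwa [invariance_sigma hB] at this
  · exact good_caseR0 P hN hB haux hj hq hr0 w7 hD

/-- The terminal parameters after the rotation `ϑ^i` that makes `j = 0` ("we may assume (up to applying a suitable
power of `ϑ`) that `j = 0`"). [cite: RhinViola2001, §2 p. 275] -/
private theorem good_of_rot_terminal (P : Params) (hN : P.Nonneg) (hB : P.Balanced) (haux : P.aux.Nonneg) (i : ℕ)
    (hj : (rot i P).j = 0)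
    (w0 : ¬(0 < (rot i P).l ∧ 0 < (rot i P).m ∧ 0 < (rot i P).q ∧ 0 < (rot i P).r))
    (w1 : ¬(0 < (rot i P).m ∧ 0 < (rot i P).q ∧ 0 < (rot i P).r ∧ 0 < (rot i P).s))
    (w2 : ¬(0 < (rot i P).q ∧ 0 < (rot i P).r ∧ 0 < (rot i P).s ∧ 0 < (rot i P).h))
    (w7 : ¬(0 < (rot i P).k ∧ 0 < (rot i P).l ∧ 0 < (rot i P).m ∧ 0 < (rot i P).q))
    {M N Q : ℤ} (hD : Dom P.S M N Q) : Good (d M * d N * d Q) (I P) := by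
  have := good_terminal_j0 (rot i P) (nonneg_rot hN i) (balanced_rot hB i) (auxNonneg_rot haux i) hj w0 w1 w2 w7
    ((dom_perm (S_rot_perm P i)).2 hD)
  rwa [I_rot P hB i] at this

/-! ### The induction -/

/-- **One step of the descent**: if (2.9) (with every dominating `M, N, Q`) holds for all non-negative balanced
parameter sets of smaller total weight, it holds for `P` — the printed case distinction of pp. 274–275.
[cite: RhinViola2001, §2 pp. 274–275 (proof of Theorem 2.1)] -/
theorem step (P : Params) (hN : P.Nonneg) (hB : P.Balanced)
    (IH : ∀ P' : Params, P'.Nonneg → P'.Balanced → total P' < total P →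
      ∀ M N Q : ℤ, Dom P'.S M N Q → Good (d M * d N * d Q) (I P'))
    (M N Q : ℤ) (hD : Dom P.S M N Q) : Good (d M * d N * d Q) (I P) := by
  -- the least of the integers (2.8) is `< 0`
  by_cases hneg : ∃ x ∈ P.S, x < 0
  · exact good_of_aux_neg hN hB hneg hD
  -- all the integers (2.8) are `≥ 0`
  have haux : P.aux.Nonneg := by
    push Not at hneg
    simp only [Params.S, Params.toList, List.forall_mem_cons] at hneg
    obtain ⟨e0, e1, e2, e3, e4, e5, e6, e7, -⟩ := hneg
    exact ⟨e0, e1, e2, e3, e4, e5, e6, e7⟩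
  have hN' := hN
  obtain ⟨h0, h1, h2, h3, h4, h5, h6, h7⟩ := hN'
  -- one of the eight products `lmqr, mqrs, qrsh, rshj, shjk, hjkl, jklm, klmq` is `> 0`
  by_cases w0 : 0 < P.l ∧ 0 < P.m ∧ 0 < P.q ∧ 0 < P.r
  · exact good_of_decomp P hN hB w0.1 w0.2.1 w0.2.2.1 w0.2.2.2 IH hD
  by_cases w1 : 0 < P.m ∧ 0 < P.q ∧ 0 < P.r ∧ 0 < P.s
  · exact good_of_rot_decomp P hN hB 1 (by rw [rot_one]; simp only; omega) IH hD
  by_cases w2 : 0 < P.q ∧ 0 < P.r ∧ 0 < P.s ∧ 0 < P.h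
  · exact good_of_rot_decomp P hN hB 2 (by rw [rot_two]; simp only; omega) IH hD
  by_cases w3 : 0 < P.r ∧ 0 < P.s ∧ 0 < P.h ∧ 0 < P.j
  · exact good_of_rot_decomp P hN hB 3 (by rw [rot_three]; simp only; omega) IH hD
  by_cases w4 : 0 < P.s ∧ 0 < P.h ∧ 0 < P.j ∧ 0 < P.k
  · exact good_of_rot_decomp P hN hB 4 (by rw [rot_four]; simp only; omega) IH hD
  by_cases w5 : 0 < P.h ∧ 0 < P.j ∧ 0 < P.k ∧ 0 < P.l
  · exact good_of_rot_decomp P hN hB 5 (by rw [rot_five]; simp only; omega) IH hD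
  by_cases w6 : 0 < P.j ∧ 0 < P.k ∧ 0 < P.l ∧ 0 < P.m
  · exact good_of_rot_decomp P hN hB 6 (by rw [rot_six]; simp only; omega) IH hD
  by_cases w7 : 0 < P.k ∧ 0 < P.l ∧ 0 < P.m ∧ 0 < P.q
  · exact good_of_rot_decomp P hN hB 7 (by rw [rot_seven]; simp only; omega) IH hD
  -- all eight products vanish: some parameter is `0`; rotate it to the place of `j`
  have hzero : P.j = 0 ∨ P.k = 0 ∨ P.l = 0 ∨ P.m = 0 ∨ P.q = 0 ∨ P.r = 0 ∨ P.s = 0 ∨ P.h = 0 := by omega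
  rcases hzero with hz | hz | hz | hz | hz | hz | hz | hz
  · exact good_of_rot_terminal P hN hB haux 0 hz w0 w1 w2 w7 hD
  · exact good_of_rot_terminal P hN hB haux 1 (by rw [rot_one]; exact hz)
      (by rw [rot_one]; simp only; omega) (by rw [rot_one]; simp only; omega)
      (by rw [rot_one]; simp only; omega) (by rw [rot_one]; simp only; omega) hD
  · exact good_of_rot_terminal P hN hB haux 2 (by rw [rot_two]; exact hz)
      (by rw [rot_two]; simp only; omega) (by rw [rot_two]; simp only; omega)
      (by rw [rot_two]; simp only; omega) (by rw [rot_two]; simp only; omega) hD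
  · exact good_of_rot_terminal P hN hB haux 3 (by rw [rot_three]; exact hz)
      (by rw [rot_three]; simp only; omega) (by rw [rot_three]; simp only; omega)
      (by rw [rot_three]; simp only; omega) (by rw [rot_three]; simp only; omega) hD
  · exact good_of_rot_terminal P hN hB haux 4 (by rw [rot_four]; exact hz)
      (by rw [rot_four]; simp only; omega) (by rw [rot_four]; simp only; omega)
      (by rw [rot_four]; simp only; omega) (by rw [rot_four]; simp only; omega) hD
  · exact good_of_rot_terminal P hN hB haux 5 (by rw [rot_five]; exact hz)
      (by rw [rot_five]; simp only; omega) (by rw [rot_five]; simp only; omega)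
      (by rw [rot_five]; simp only; omega) (by rw [rot_five]; simp only; omega) hD
  · exact good_of_rot_terminal P hN hB haux 6 (by rw [rot_six]; exact hz)
      (by rw [rot_six]; simp only; omega) (by rw [rot_six]; simp only; omega)
      (by rw [rot_six]; simp only; omega) (by rw [rot_six]; simp only; omega) hD
  · exact good_of_rot_terminal P hN hB haux 7 (by rw [rot_seven]; exact hz)
      (by rw [rot_seven]; simp only; omega) (by rw [rot_seven]; simp only; omega)
      (by rw [rot_seven]; simp only; omega) (by rw [rot_seven]; simp only; omega) hD

/-- **Theorem 2.1 with every dominating triple `M, N, Q`**, by induction on `h+j+k+l+m+q+r+s` ("if we iterate the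
linear decomposition (2.10) sufficiently many times, in finitely many steps we express `I` as a linear combination
with integer coefficients of integrals, for each of which either the least of the integers (2.8) is `< 0`, or
`lmqr = 0`"). [cite: RhinViola2001, Theorem 2.1 and §2 p. 275] -/
theorem main : ∀ (n : ℕ) (P : Params), P.Nonneg → P.Balanced → (total P).toNat = n →
    ∀ M N Q : ℤ, Dom P.S M N Q → Good (d M * d N * d Q) (I P) := by
  intro n
  induction n using Nat.strong_induction_on with
  | h n ih =>
    intro P hN hB hn M N Q hD
    refine step P hN hB (fun P' hN' hB' hlt M' N' Q' hD' => ?_) M N Q hD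
    have h0 := total_nonneg hN'
    have h1 := total_nonneg hN
    exact ih (total P').toNat (by omega) P' hN' hB' rfl M' N' Q' hD'

/-! ### Theorem 2.1 for every dominating triple; the denominators (5.3) of §5 -/

/-- Sublists inherit domination (the integers (2.8) form a sublist of the sixteen integers `T` of §5).
[cite: RhinViola2001, §5 p. 287 ((5.3) and "By Theorem 2.1 we have `d_M d_N d_Q a ∈ ℤ`")] -/
theorem dom_sublist {L L' : List ℤ} (h : L'.Sublist L) {M N Q : ℤ} (hD : Dom L M N Q) : Dom L' M N Q :=
  ⟨Nat.le_zero.1 (h.countP_le.trans hD.1.le), h.countP_le.trans hD.2.1, h.countP_le.trans hD.2.2⟩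

/-- `S = (h′, …, s′)` is a sublist of `T = (h, …, s, h′, …, s′)`. [cite: RhinViola2001, §5 p. 287 (definition of `T`)] -/
theorem S_sublist_T (P : Params) : P.S.Sublist P.T := by
  rw [Params.T, Params.S]; exact List.sublist_append_right _ _

/-- `T` has sixteen entries. [cite: RhinViola2001, §5 p. 287] -/
theorem length_T (P : Params) : P.T.length = 16 := by
  simp [Params.T, Params.toList]

/-- `I_n`'s parameters `(hn, …, sn)` are non-negative for `n ≥ 0`. [cite: RhinViola2001, §5 (5.2)] -/
theorem nonneg_scale {P : Params} (hN : P.Nonneg) {n : ℤ} (hn : 0 ≤ n) : (P.scale n).Nonneg := by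
  obtain ⟨h0, h1, h2, h3, h4, h5, h6, h7⟩ := hN
  exact ⟨mul_nonneg hn h0, mul_nonneg hn h1, mul_nonneg hn h2, mul_nonneg hn h3, mul_nonneg hn h4,
    mul_nonneg hn h5, mul_nonneg hn h6, mul_nonneg hn h7⟩

/-- `I_n`'s parameters satisfy (2.2)–(2.3). [cite: RhinViola2001, §5 (5.2)] -/
theorem balanced_scale {P : Params} (hB : P.Balanced) (n : ℤ) : (P.scale n).Balanced := by
  obtain ⟨h1, h2⟩ := hB
  constructor
  · show n * P.h + n * P.m = n * P.k + n * P.r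
    rw [← mul_add, ← mul_add, h1]
  · show n * P.j + n * P.q = n * P.l + n * P.s
    rw [← mul_add, ← mul_add, h2]

/-- The sixteen integers of `I_n` are those of `I`, multiplied by `n`. [cite: RhinViola2001, §5 (5.2)–(5.3)] -/
theorem T_scale (P : Params) (n : ℤ) : (P.scale n).T = P.T.map (fun x => n * x) := by
  simp only [Params.T, Params.toList, Params.aux, Params.scale, List.cons_append, List.nil_append, List.map_cons,
    List.map_nil, mul_add, mul_sub]

/-- Domination scales: if `M, N, Q` dominate `T`, then `nM, nN, nQ` dominate the sixteen integers of `I_n` (`n ≥ 1`).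
[cite: RhinViola2001, §5 (5.3)] -/
theorem dom_scale_T {P : Params} {n : ℤ} (hn : 0 < n) {M N Q : ℤ} (hD : Dom P.T M N Q) :
    Dom (P.scale n).T (n * M) (n * N) (n * Q) := by
  rw [T_scale]
  unfold Dom at hD ⊢
  simp only [List.countP_map, Function.comp_def, mul_lt_mul_iff_right₀ hn]
  exact hD

/-- **Theorem 2.1 for every dominating triple**: if no integer (2.8) exceeds `M`, at most one exceeds `N` and at most
two exceed `Q`, then `I(h,j,k,l,m,q,r,s) = a + 2bζ(3)` with `b ∈ ℤ`, `a ∈ ℚ`, `d_M d_N d_Q a ∈ ℤ` (for the successive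
maxima of (2.8) this is Theorem 2.1 as printed — the tree's `theorem21_holds`; the form below is the one used with
the maxima (5.3) of §5). [cite: RhinViola2001, Theorem 2.1 (pp. 273–275) and §5 p. 287] -/
theorem theorem21_of_dom (P : Params) (hN : P.Nonneg) (hB : P.Balanced) {M N Q : ℤ} (hD : Dom P.S M N Q) :
    ∃ (a : ℚ) (b : ℤ), I P = a + 2 * b * zetaValue 3 ∧ ∃ A : ℤ, ((d M * d N * d Q : ℕ) : ℚ) * a = A :=
  main _ P hN hB rfl M N Q hD

/-- **§5, (5.3)**: "Let `T` denote the sequence of the integers (5.1) and (4.7) … `M = max T`, `N = max′ T`,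
`Q = max″ T`. By Theorem 2.1 we have `d_M d_N d_Q a ∈ ℤ` and `b ∈ ℤ`" — with the successive maxima `maxT` of the
SIXTEEN integers. [cite: RhinViola2001, §5 p. 287, (5.3)] -/
theorem theorem21_maxT (P : Params) (hN : P.Nonneg) (hB : P.Balanced) :
    ∃ (a : ℚ) (b : ℤ), I P = a + 2 * b * zetaValue 3 ∧
      ∃ A : ℤ, ((d (maxT P 0) * d (maxT P 1) * d (maxT P 2) : ℕ) : ℚ) * a = A := by
  have hT : Dom P.T (maxT P 0) (maxT P 1) (maxT P 2) := by
    unfold maxT; exact dom_succMax P.T (by rw [length_T]; norm_num)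
  exact theorem21_of_dom P hN hB (dom_sublist (S_sublist_T P) hT)

/-- **§5, (5.2)–(5.3)**: for `I_n = I(hn, jn, kn, ln, mn, qn, rn, sn) = a_n + 2b_nζ(3)` (`n ≥ 1`) one has `b_n ∈ ℤ` and
`d_{Mn} d_{Nn} d_{Qn} a_n ∈ ℤ` with `M, N, Q` the maxima (5.3) of the sixteen integers of `I` — "the integer
`A_n = d_{Mn} d_{Nn} d_{Qn} a_n`". [cite: RhinViola2001, §5 p. 287 ((5.2), (5.3), definition of `A_n`)] -/
theorem theorem21_scale (P : Params) (hN : P.Nonneg) (hB : P.Balanced) {n : ℕ} (hn : 1 ≤ n) :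
    ∃ (a : ℚ) (b : ℤ), I (P.scale n) = a + 2 * b * zetaValue 3 ∧
      ∃ A : ℤ, ((d (n * maxT P 0) * d (n * maxT P 1) * d (n * maxT P 2) : ℕ) : ℚ) * a = A := by
  have hT : Dom P.T (maxT P 0) (maxT P 1) (maxT P 2) := by
    unfold maxT; exact dom_succMax P.T (by rw [length_T]; norm_num)
  have hn' : (0 : ℤ) < n := by exact_mod_cast hn
  have hS : Dom (P.scale n).S ((n : ℤ) * maxT P 0) (n * maxT P 1) (n * maxT P 2) :=
    dom_sublist (S_sublist_T _) (dom_scale_T hn' hT)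
  exact theorem21_of_dom (P.scale n) (nonneg_scale hN hn'.le) (balanced_scale hB n) hS

end Theorem21

end Literature.NumberTheory.Irrationality.RhinViola2001

end
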